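import Mathlib
import Literature.NumberTheory.EllipticCurves.RootNumber
import Literature.NumberTheory.DiophantineGeometry.Conductor
import Literature.NumberTheory.EllipticCurves.BSDInvariants
import Summits.Parity.BatemanHorn.Theses.IsogenyRedei

/-!
# Sketch — crux-ideate stmt-Parity-11585 (QuadraticOmegaParity), ideator 1, round 1

First lemmas of the idea cards in `Ideas/`. Nothing here is proved; every `def … : Prop`
must elaborate over existing declarations (Mathlib `WeierstrassCurve.LFunction`,
Literature `WeierstrassCurve.rootNumber`, `WeierstrassCurve.conductorNorm`).
-/

noncomputable section

open scoped BigOperators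
open Filter

namespace Summit.Parity.BatemanHorn.Cruxes.QuadraticOmegaParity.AfeGuoSign

/-- The route's 2-isogenous pencil `E_t : y² = x³ + 2t x² + (t²+1) x` over `ℚ`
(IsogenyRedei, item PencilSelmerDictionary). -/
def pencil (t : ℕ) : WeierstrassCurve ℚ := ⟨0, 2 * (t : ℚ), 0, (t : ℚ) ^ 2 + 1, 0⟩

/-- Buhler–Gross–Zagier / Cremona series `I_t(X) = Σ_{n≥1} (a_n(E_t)/n) exp(−2πn/(X√N_t))`,
`N_t` the conductor; `L(E_t,1) = I_t(X) + w(E_t) I_t(1/X)` for every `X > 0`. -/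
def bgzSum (t : ℕ) (X : ℝ) : ℝ :=
  ∑' n : ℕ, (((pencil t).LFunction n : ℤ) : ℝ) / (n : ℝ) *
    Real.exp (-(2 * Real.pi * (n : ℝ)) / (X * Real.sqrt (((pencil t).conductorNorm ℤ : ℕ) : ℝ)))

/-- The central AFE polynomial `A_t = I_t(1)`; `L(E_t,1) = (1 + w(E_t)) A_t`. -/
def afeCentral (t : ℕ) : ℝ := bgzSum t 1

/-- GUO CRITERION (theorem in print: Guo 1996 `L(E,1) ≥ 0` + the BGZ identity):
a negative central AFE polynomial certifies root number `−1`. -/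
def GuoCriterion : Prop :=
  ∀ t : ℕ, 1 ≤ t → afeCentral t < 0 → (pencil t).rootNumber = -1

/-- ANTISYMMETRIC ANNIHILATION (theorem in print: functional equation, BCDT + Hecke):
root number `−1` forces `I_t(X) = I_t(1/X)`; contrapositively `I_t(2) ≠ I_t(1/2)` certifies `+1`. -/
def AntisymmetricAnnihilation : Prop :=
  ∀ t : ℕ, 1 ≤ t → (pencil t).rootNumber = -1 → ∀ X : ℝ, 0 < X → bgzSum t X = bgzSum t X⁻¹

/-- PENCIL ROOT NUMBER (theorem in print: Rohrlich's local signs on the split-multiplicative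
fibres + 2-adic local constancy; the root-number half of PencilSelmerDictionary):
`w(E_t) = −w₂(t)·(−1)^{#odd primes ∣ t²+1}` with `w₂` periodic modulo a power of `2`. -/
def PencilRootNumber : Prop :=
  ∃ M : ℕ, ∃ w : ℕ → ℤ, (∀ t, w (t + 2 ^ M) = w t) ∧ ∀ t : ℕ, 1 ≤ t →
    (pencil t).rootNumber =
      -(w t * (-1 : ℤ) ^ (((t ^ 2 + 1).primeFactors.filter (fun p : ℕ => p ≠ 2)).card))

/-- TEETH (the first open, checkable statement of the line): the Guo certificate fires on a set
of positive lower density in every arithmetic progression. -/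
def Teeth : Prop :=
  ∀ q a : ℕ, 0 < q → ∃ c : ℝ, 0 < c ∧ ∀ᶠ x : ℕ in atTop,
    c * (x : ℝ) ≤ (((Finset.Icc 1 x).filter (fun t : ℕ => t ≡ a [MOD q] ∧ afeCentral t < 0)).card : ℝ)

/-- FIRST MOMENT of the central AFE polynomial along the pencil in progressions (theorem-track:
Poisson in `t`, the family's Fourier dual is a Salié/Kloosterman sum, Deligne + Kuznetsov). -/
def FirstMomentPencil : Prop :=
  ∀ q a : ℕ, 0 < q → ∃ c : ℝ,
    (fun x : ℕ => (∑ t ∈ (Finset.Icc 1 x).filter (fun t : ℕ => t ≡ a [MOD q]), afeCentral t)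
        - c * (((Finset.Icc 1 x).filter (fun t : ℕ => t ≡ a [MOD q])).card : ℝ))
      =o[atTop] fun x : ℕ => (x : ℝ)

/-- SECOND MOMENT (the analytic crux of the line: family size `x` against conductor `≍ x²`;
needs cancellation in sums of Salié sums with entangled inverses beyond Weil). -/
def SecondMomentPencil : Prop :=
  ∃ C : ℝ, ∀ᶠ x : ℕ in atTop,
    (∑ t ∈ Finset.Icc 1 x, (afeCentral t) ^ 2) ≤ C * (x : ℝ) * Real.log x

/-- The parity rung the certificates reach first: in every progression, root number `−1`
(equivalently, by PencilRootNumber, `(−1)^{ω_odd(t²+1)} = w₂(t)`) has positive lower density.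
`GuoCriterion ∧ Teeth → PositiveDensityOddSign` is immediate. -/
def PositiveDensityOddSign : Prop :=
  ∀ q a : ℕ, 0 < q → ∃ c : ℝ, 0 < c ∧ ∀ᶠ x : ℕ in atTop,
    c * (x : ℝ) ≤ (((Finset.Icc 1 x).filter
      (fun t : ℕ => t ≡ a [MOD q] ∧ (pencil t).rootNumber = -1)).card : ℝ)

/-- The certificates' bookkeeping: Guo criterion plus teeth gives the positive-density rung. -/
theorem positiveDensityOddSign_of (hG : GuoCriterion) (hT : Teeth) : PositiveDensityOddSign := by
  intro q a hq
  obtain ⟨c, hc, hev⟩ := hT q a hq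
  refine ⟨c, hc, hev.mono fun x hx => le_trans hx ?_⟩
  exact_mod_cast Finset.card_le_card (fun t ht => by
    simp only [Finset.mem_filter, Finset.mem_Icc] at ht ⊢
    exact ⟨ht.1, ht.2.1, hG t ht.1.1 ht.2.2⟩)

/-- Cremona's derivative series `B_t = Σ_{n≥1} (a_n(E_t)/n) E₁(2πn/√N_t)` (`E₁` the exponential
integral, written as `∫_{1}^{∞} e^{-c n y}/y dy`); `Λ'(E_t,1) ∝ (1 − w(E_t)) B_t`. -/
def bgzDerivSum (t : ℕ) : ℝ :=
  ∑' n : ℕ, (((pencil t).LFunction n : ℤ) : ℝ) / (n : ℝ) *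
    ∫ y in Set.Ioi (1 : ℝ), Real.exp (-(2 * Real.pi * (n : ℝ)) /
      Real.sqrt (((pencil t).conductorNorm ℤ : ℕ) : ℝ) * y) / y

/-- GROSS–ZAGIER CRITERION (theorem in print: Gross–Zagier 1986 + Bump–Friedberg–Hoffstein /
Murty–Murty non-vanishing of a Heegner twist + Guo/Kohnen–Zagier positivity of that twist give
`L'(E,1) ≥ 0` whenever `w(E) = −1`; with Cremona's identity `L'(E,1) = 2 B` for `w = −1`):
a negative derivative polynomial certifies root number `+1`. -/
def GZCriterion : Prop :=
  ∀ t : ℕ, 1 ≤ t → bgzDerivSum t < 0 → (pencil t).rootNumber = 1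

/-- TEETH-PLUS: the Gross–Zagier certificate fires on a set of positive lower density in every
arithmetic progression. -/
def TeethPlus : Prop :=
  ∀ q a : ℕ, 0 < q → ∃ c : ℝ, 0 < c ∧ ∀ᶠ x : ℕ in atTop,
    c * (x : ℝ) ≤ (((Finset.Icc 1 x).filter (fun t : ℕ => t ≡ a [MOD q] ∧ bgzDerivSum t < 0)).card : ℝ)

/-- The even-sign rung: in every progression, root number `+1` (equivalently `(−1)^{ω_odd(t²+1)}
= −w₂(t)`) has positive lower density. `GZCriterion ∧ TeethPlus → PositiveDensityEvenSign`. -/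
def PositiveDensityEvenSign : Prop :=
  ∀ q a : ℕ, 0 < q → ∃ c : ℝ, 0 < c ∧ ∀ᶠ x : ℕ in atTop,
    c * (x : ℝ) ≤ (((Finset.Icc 1 x).filter
      (fun t : ℕ => t ≡ a [MOD q] ∧ (pencil t).rootNumber = 1)).card : ℝ)

theorem positiveDensityEvenSign_of (hG : GZCriterion) (hT : TeethPlus) :
    PositiveDensityEvenSign := by
  intro q a hq
  obtain ⟨c, hc, hev⟩ := hT q a hq
  refine ⟨c, hc, hev.mono fun x hx => le_trans hx ?_⟩
  exact_mod_cast Finset.card_le_card (fun t ht => by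
    simp only [Finset.mem_filter, Finset.mem_Icc] at ht ⊢
    exact ⟨ht.1, ht.2.1, hG t ht.1.1 ht.2.2⟩)

/-- INTEGRALITY UPGRADE of the Guo certificate (theorem in print modulo a uniform denominator:
Manin–Drinfeld rationality of `L(E,1)/Ω⁺`, denominators bounded through `#E(ℚ)_tors`, the Manin
constant and the isogeny-class position, + Guo): on `w = +1` fibres `2A_t/Ω⁺_t` is a non-negative
rational with bounded denominator, so a value of `2m A_t/Ω⁺_t` off `ℤ_{≥0}` certifies `w = −1`
(generically every `w = −1` fibre: full teeth). The uniform `m` is part of the claim (kit j007231). -/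
def IntegralityCertificate : Prop :=
  ∃ m : ℕ, 0 < m ∧ ∀ t : ℕ, 1 ≤ t → (pencil t).rootNumber = 1 →
    ∃ k : ℕ, 2 * (m : ℝ) * afeCentral t = k * (pencil t).realPeriodRat

/-- ATOM-HALF (the crux in certificate currency): along every progression the root number of the
pencil is equidistributed. With PencilRootNumber (periodic `w₂`, progressions refined modulo
`2^M`) this is `QuadraticOmegaParity` for `f = X²+1`, up to the prime `2`. -/
def AtomHalf : Prop :=
  ∀ q a : ℕ, 0 < q →
    (fun x : ℕ => ∑ t ∈ (Finset.Icc 1 x).filter (fun t : ℕ => t ≡ a [MOD q]),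
        ((pencil t).rootNumber : ℝ)) =o[atTop] fun x : ℕ => (x : ℝ)

end Summit.Parity.BatemanHorn.Cruxes.QuadraticOmegaParity.AfeGuoSign
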